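import Literature.Geometry.Kaehler.SiegelTorusThetaCharacteristicTransitive
import Literature.Geometry.Kaehler.SiegelTorusThetaNullCount
import HarnessLib

/-!
# The permutation representation of `Γ_g` on the theta characteristics: its kernel is `Γ_g(2)`
# (`γ_M` depends only on `M mod 2`), and its two orbits are the `2^{g−1}(2^g+1)` even and the
# `2^{g−1}(2^g−1)` odd characteristics

Layer `Literature/Geometry/Kaehler`, namespace `Literature.Geometry.Kaehler.ComplexTorus` (lane
`lit-hodgefound`, Layer A4, theta-divisor row A4-17; prover seat `lit-hodgefound-p23`, row «A4-17(w)»).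
Sequel of `SiegelTorusThetaCharacteristicTransitive.lean` (transitivity on the even / odd
characteristics), `SiegelTorusThetaCharacteristicAction.lean` (`γ_M = symplecticCharPerm hM`,
`p ↦ \overline{ᵗM⁻¹} p + \overline{(diag(cdᵗ); diag(abᵗ))}`) and
`SiegelTorusThetaCharacteristicActionHom.lean` (the homomorphism `symplecticCharAction`).

Source followed (held text, read at the quoted lines): S. Grushevsky, R. Salvati Manni, *Gradients of
odd theta functions* (2004) [held `paper:arxiv-math_0310085` p0003 L19–L25, L99–L110]:
"`Γ_g(n) := {γ ∈ Γ_g | γ ≡ 1 mod n}` … `γ ∈ Γ_g(4,8)` acts trivially on the characteristics `[ε,δ]` …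
The action of `Γ_g/Γ_g(2)` on the set of characteristics is by permutations." Precisely: `γ_M` is the
identity permutation of `(ℤ/2)^{2g}` **iff** `M ≡ 1 (mod 2)`, so `M ↦ γ_M` factors through
`Γ_g/Γ_g(2) ≅ Sp_{2g}(ℤ/2)` and `γ_M` depends only on `M̄ = M mod 2`. (For `M ≡ 1 (mod 2)` the linear
part `\overline{ᵗM⁻¹}` is `1` and the shift `(diag(cdᵗ); diag(abᵗ))` is even since `c ≡ b ≡ 0`;
conversely `γ_M = id` at `p = 0` kills the shift and at the basis vectors forces `\overline{ᵗM⁻¹} = 1`.)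
The orbits [same text, L65–L68 and L86–L88]: "The number of even (resp. odd) characteristics is
`2^{g−1}(2^g+1)` (resp. `2^{g−1}(2^g−1)`) … the parity of the characteristics is an invariant" — with the
transitivity of `SiegelTorusThetaCharacteristicTransitive.lean` the orbit `Γ_g·p` IS the set of
characteristics of the parity of `p`, of that size (the counts are the tree's `ncard_setOf_pairing_eq_zero/one`).

What is here (theorems only; no definition, no named fact, net debt `0`).

* **`symplecticCharPerm_eq_of_map_eq`** / `symplecticCharAction_eq_of_map_eq` /
  `symplecticCharPerm_apply_eq_of_map_eq` (`γ_M` depends only on `M mod 2`),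
  `symplecticCharPerm_eq_refl_of_map_eq_one` (`M ≡ 1 mod 2 ⇒ γ_M = id`),
  `map_eq_one_of_symplecticCharPerm_eq_refl` (the converse),
  **`symplecticCharPerm_eq_refl_iff`**, **`symplecticCharAction_eq_one_iff`** (the kernel is `Γ_g(2)`).
* **`orbit_symplecticCharAction_eq`** (`Γ_g·p = {q | parity q = parity p}`), **`ncard_orbit_symplecticCharAction_of_even`**
  (`= 2^{g−1}(2^g+1)`), **`ncard_orbit_symplecticCharAction_of_odd`** (`= 2^{g−1}(2^g−1)`),
  `ncard_orbit_symplecticCharAction_zero`.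

## References

* [GrushevskySalvatiManni2004Gradients] S. Grushevsky, R. Salvati Manni, *Gradients of odd theta
  functions*, J. reine angew. Math. 573 (2004), 45–59 (arXiv:math/0310085), p. 3 L19–L25, L65–L68,
  L86–L88 and L99–L110 of the held text.
* [ArbarelloCornalbaGriffithsHarris1985] E. Arbarello, M. Cornalba, P. A. Griffiths, J. Harris, *Geometry
  of Algebraic Curves I*, Grundlehren 267, Springer (1985), Appendix B, p0223 Theorem (***) of the held text.
* [Lange2023AbelianVarietiesComplex] H. Lange, *Abelian Varieties over the Complex Numbers* (2023),
  §3.3.1 Lemma 3.3.1, §3.3.3 (the level groups).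
* [MumfordTata1] D. Mumford, *Tata Lectures on Theta I*, Ch. II §5.
-/

noncomputable section

open scoped Manifold Topology
open scoped Real
open Set Function Complex Matrix Filter
open Literature.Analysis.SpecialFunctions Literature.Analysis.Complex

namespace Literature.Geometry.Kaehler

namespace ComplexTorus

open Literature.NumberTheory.Automorphic (siegelUpperHalfSpace)
open Literature.NumberTheory.ModularForms.SiegelUpperHalfSpace (moeb denom)

variable {n : ℕ}

section LevelTwo

variable {M M' : Matrix (Fin n ⊕ Fin n) (Fin n ⊕ Fin n) ℤ}

/-- **`γ_M` depends only on `M mod 2`**: `M ≡ M' (mod 2)` implies `γ_M = γ_{M'}` (both the linear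
part `\overline{(d −c; −b a)}` and the shift `\overline{(diag(cdᵗ); diag(abᵗ))}` are read off `M̄`) —
"the action of `Γ_g/Γ_g(2)` on the set of characteristics".
[cite: GrushevskySalvatiManni2004Gradients, p0003 L99–L110 of the held text] -/
theorem symplecticCharPerm_eq_of_map_eq (hM : M ∈ Matrix.symplecticGroup (Fin n) ℤ)
    (hM' : M' ∈ Matrix.symplecticGroup (Fin n) ℤ)
    (h : M.map (Int.castRingHom (ZMod 2)) = M'.map (Int.castRingHom (ZMod 2))) :
    symplecticCharPerm hM = symplecticCharPerm hM' := by
  have he : ∀ a b, ((M a b : ℤ) : ZMod 2) = ((M' a b : ℤ) : ZMod 2) := fun a b ↦ by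
    have := congrFun (congrFun h a) b
    simpa only [Matrix.map_apply, eq_intCast] using this
  refine Equiv.ext fun p ↦ ?_
  have hN : (charActionMatrix M).map (Int.castRingHom (ZMod 2)) =
      (charActionMatrix M').map (Int.castRingHom (ZMod 2)) := by
    ext s t
    rcases s with i | i <;> rcases t with j | j <;>
      simp [charActionMatrix, Matrix.toBlocks₁₁, Matrix.toBlocks₁₂, Matrix.toBlocks₂₁, Matrix.toBlocks₂₂, he]
  have hc : (fun s ↦ ((charActionShift M s : ℤ) : ZMod 2)) =
      fun s ↦ ((charActionShift M' s : ℤ) : ZMod 2) := by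
    funext s
    rcases s with i | i <;>
      simp [charActionShift, Matrix.diag_apply, Matrix.mul_apply, Matrix.toBlocks₁₁, Matrix.toBlocks₁₂,
        Matrix.toBlocks₂₁, Matrix.toBlocks₂₂, he]
  rw [symplecticCharPerm_apply, symplecticCharPerm_apply, hN, hc]

/-- **`Γ_g(2)` acts trivially on the characteristics**: if `M ∈ Sp_{2g}(ℤ)` and `M ≡ 1 (mod 2)` then
`γ_M` is the identity permutation of `(ℤ/2)^{2g}` ("`γ ∈ Γ_g(4,8)` acts trivially on the
characteristics" — already `Γ_g(2)` does). [cite: GrushevskySalvatiManni2004Gradients, p0003 L99–L110 of the held text] -/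
theorem symplecticCharPerm_eq_refl_of_map_eq_one (hM : M ∈ Matrix.symplecticGroup (Fin n) ℤ)
    (h2 : M.map (Int.castRingHom (ZMod 2)) = 1) :
    symplecticCharPerm hM = Equiv.refl (Fin n ⊕ Fin n → ZMod 2) := by
  rw [← symplecticCharPerm_one (n := n)]
  exact symplecticCharPerm_eq_of_map_eq hM (one_mem _) (by rw [h2, Matrix.map_one _ (map_zero _) (map_one _)])

/-- **Conversely, only `Γ_g(2)` acts trivially**: if `γ_M = id` then `M ≡ 1 (mod 2)` (at `p = 0` the
shift vanishes; at the basis vectors `\overline{ᵗM⁻¹} = 1`, whence `M̄ = 1` by `ᵗM⁻¹ ᵗM = 1`).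
[cite: GrushevskySalvatiManni2004Gradients, p0003 L99–L110 of the held text] -/
theorem map_eq_one_of_symplecticCharPerm_eq_refl (hM : M ∈ Matrix.symplecticGroup (Fin n) ℤ)
    (h : symplecticCharPerm hM = Equiv.refl (Fin n ⊕ Fin n → ZMod 2)) :
    M.map (Int.castRingHom (ZMod 2)) = 1 := by
  have happ : ∀ p, symplecticCharPerm hM p = p := fun p ↦ by rw [h, Equiv.refl_apply]
  -- the shift is `0`
  have h0 : (fun s ↦ ((charActionShift M s : ℤ) : ZMod 2)) = 0 := by
    have := happ 0
    rwa [symplecticCharPerm_apply, Matrix.mulVec_zero, zero_add] at this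
  -- the linear part is `1`
  have hN : (charActionMatrix M).map (Int.castRingHom (ZMod 2)) = 1 := by
    ext s t
    have := congrFun (happ (Pi.single t 1)) s
    rw [symplecticCharPerm_apply, h0, add_zero, Matrix.mulVec_single_one, Matrix.col_apply] at this
    rw [this, Matrix.one_apply, Pi.single_apply]
  -- `N̄ ᵗM̄ = 1` with `N̄ = 1`
  have h1 : (charActionMatrix M).map (Int.castRingHom (ZMod 2)) *
      (M.map (Int.castRingHom (ZMod 2)))ᵀ = 1 := by
    rw [← Matrix.transpose_map, ← Matrix.map_mul, charActionMatrix_mul_transpose hM,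
      Matrix.map_one _ (map_zero _) (map_one _)]
  rw [hN, Matrix.one_mul] at h1
  rw [← Matrix.transpose_transpose (M.map _), h1, Matrix.transpose_one]

/-- **The kernel of the action on characteristics is `Γ_g(2)`**: `γ_M = id ↔ M ≡ 1 (mod 2)`.
[cite: GrushevskySalvatiManni2004Gradients, p0003 L19–L25 and L99–L110 of the held text] -/
theorem symplecticCharPerm_eq_refl_iff (hM : M ∈ Matrix.symplecticGroup (Fin n) ℤ) :
    symplecticCharPerm hM = Equiv.refl (Fin n ⊕ Fin n → ZMod 2) ↔
      M.map (Int.castRingHom (ZMod 2)) = 1 :=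
  ⟨map_eq_one_of_symplecticCharPerm_eq_refl hM, symplecticCharPerm_eq_refl_of_map_eq_one hM⟩

/-- **The kernel of `symplecticCharAction : Sp_{2g}(ℤ) →* 𝔖((ℤ/2)^{2g})` is `Γ_g(2)`**:
`symplecticCharAction M = 1 ↔ M ≡ 1 (mod 2)`. [cite: GrushevskySalvatiManni2004Gradients, p0003 L99–L110 of the held text] -/
theorem symplecticCharAction_eq_one_iff (M : Matrix.symplecticGroup (Fin n) ℤ) :
    symplecticCharAction M = 1 ↔
      (M : Matrix (Fin n ⊕ Fin n) (Fin n ⊕ Fin n) ℤ).map (Int.castRingHom (ZMod 2)) = 1 :=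
  symplecticCharPerm_eq_refl_iff M.2

/-- `symplecticCharAction M` depends only on `M mod 2` (bundled form).
[cite: GrushevskySalvatiManni2004Gradients, p0003 L99–L110 of the held text] -/
theorem symplecticCharAction_eq_of_map_eq (M M' : Matrix.symplecticGroup (Fin n) ℤ)
    (h : (M : Matrix (Fin n ⊕ Fin n) (Fin n ⊕ Fin n) ℤ).map (Int.castRingHom (ZMod 2)) =
      (M' : Matrix (Fin n ⊕ Fin n) (Fin n ⊕ Fin n) ℤ).map (Int.castRingHom (ZMod 2))) :
    symplecticCharAction M = symplecticCharAction M' :=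
  symplecticCharPerm_eq_of_map_eq M.2 M'.2 h

/-- **Conjugate elements modulo `Γ_g(2)` have the same fixed characteristics / the same orbits**: for
`M ≡ M' (mod 2)` and every `p`, `γ_M(p) = γ_{M'}(p)`. [cite: GrushevskySalvatiManni2004Gradients, p0003 L99–L110 of the held text] -/
theorem symplecticCharPerm_apply_eq_of_map_eq (hM : M ∈ Matrix.symplecticGroup (Fin n) ℤ)
    (hM' : M' ∈ Matrix.symplecticGroup (Fin n) ℤ)
    (h : M.map (Int.castRingHom (ZMod 2)) = M'.map (Int.castRingHom (ZMod 2))) (p : Fin n ⊕ Fin n → ZMod 2) :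
    symplecticCharPerm hM p = symplecticCharPerm hM' p := by
  rw [symplecticCharPerm_eq_of_map_eq hM hM' h]

end LevelTwo

/-! ### §2 The two orbits and their sizes -/

section Orbits

/-- **The orbit `Γ_g · p` is the set of characteristics with the parity of `p`.**
[cite: GrushevskySalvatiManni2004Gradients, p0003 L86–L88 of the held text]
[cite: ArbarelloCornalbaGriffithsHarris1985, Appendix B, Exercises 51–54, Theorem (***) (p0223) of the held text] -/
theorem orbit_symplecticCharAction_eq (p : Fin n ⊕ Fin n → ZMod 2) :
    {q | ∃ M : Matrix.symplecticGroup (Fin n) ℤ, symplecticCharAction M p = q} =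
      {q | ∑ i, q (Sum.inl i) * q (Sum.inr i) = ∑ i, p (Sum.inl i) * p (Sum.inr i)} := by
  ext q
  simp only [Set.mem_setOf_eq]
  rw [exists_symplecticCharAction_apply_eq_iff, eq_comm]

/-- **The orbit of an even characteristic has `2^{g−1}(2^g+1)` elements** (`g ≥ 1`).
[cite: GrushevskySalvatiManni2004Gradients, p0003 L65–L68 and L86–L88 of the held text] -/
theorem ncard_orbit_symplecticCharAction_of_even (hn : 0 < n) {p : Fin n ⊕ Fin n → ZMod 2}
    (hp : ∑ i, p (Sum.inl i) * p (Sum.inr i) = 0) :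
    {q | ∃ M : Matrix.symplecticGroup (Fin n) ℤ, symplecticCharAction M p = q}.ncard =
      2 ^ (n - 1) * (2 ^ n + 1) := by
  rw [orbit_symplecticCharAction_eq, hp]
  exact ncard_setOf_pairing_eq_zero hn

/-- **The orbit of an odd characteristic has `2^{g−1}(2^g−1)` elements** (`g ≥ 1`).
[cite: GrushevskySalvatiManni2004Gradients, p0003 L65–L68 and L86–L88 of the held text]
[cite: GrushevskySalvatiManni2009HighMultiplicity, p0009 L38 of the held text] -/
theorem ncard_orbit_symplecticCharAction_of_odd (hn : 0 < n) {p : Fin n ⊕ Fin n → ZMod 2}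
    (hp : ∑ i, p (Sum.inl i) * p (Sum.inr i) = 1) :
    {q | ∃ M : Matrix.symplecticGroup (Fin n) ℤ, symplecticCharAction M p = q}.ncard =
      2 ^ (n - 1) * (2 ^ n - 1) := by
  rw [orbit_symplecticCharAction_eq, hp]
  exact ncard_setOf_pairing_eq_one hn

/-- The orbit of `0` (the even characteristics) has `2^{g−1}(2^g+1)` elements.
[cite: GrushevskySalvatiManni2004Gradients, p0003 L65–L68 of the held text] -/
theorem ncard_orbit_symplecticCharAction_zero (hn : 0 < n) :
    {q | ∃ M : Matrix.symplecticGroup (Fin n) ℤ, symplecticCharAction M 0 = q}.ncard =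
      2 ^ (n - 1) * (2 ^ n + 1) :=
  ncard_orbit_symplecticCharAction_of_even hn (by simp)

/-- **Two orbits**: the orbits of `p` and `q` coincide or are disjoint according to the parities, and
there are characteristics of both parities once `g ≥ 1` — e.g. `0` (even) and `(ē₀; ē₀)` (odd) lie in
different orbits. [cite: GrushevskySalvatiManni2004Gradients, p0003 L86–L88 of the held text] -/
theorem symplecticCharAction_zero_ne_single (hn : 0 < n) (M : Matrix.symplecticGroup (Fin n) ℤ) :
    symplecticCharAction M 0 ≠
      Sum.elim (Pi.single (⟨0, hn⟩ : Fin n) (1 : ZMod 2)) (Pi.single (⟨0, hn⟩ : Fin n) (1 : ZMod 2)) := by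
  refine symplecticCharAction_apply_ne_of_parity_ne ?_ M
  simp only [Pi.zero_apply, mul_zero, Finset.sum_const_zero, Sum.elim_inl, Sum.elim_inr]
  rw [Finset.sum_eq_single (⟨0, hn⟩ : Fin n) (fun b _ hb ↦ by simp [hb]) (by simp)]
  simp

end Orbits


end ComplexTorus

end Literature.Geometry.Kaehler

end
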